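import Mathlib
import Literature.MathematicalPhysics.QuantumFieldTheory.Balaban1983to89.B10LargeFieldSum
import Literature.MathematicalPhysics.QuantumFieldTheory.Balaban1983to89.B10Assembly

/-!
# `Summit.QuantumFields.Balaban3D.Proofs.LargeFieldKnit` — lane «pub-balaban3d» (Bałaban, CMP **102** (1985) 255–275,
# d = 3 lattice UV stability AS PRINTED), prover seat p2: the LARGE-FIELD side of Sect. D, pp. 273–274, knitted to the
# leaf system of the 4D cell's `B10Assembly.LeafSystem` — (67)–(71) «for all plaquettes in all large fields set P» ⇒
# `B10LargeFieldSum.SmallFactorsAll`, and the three large-field leaves ⇒ the field `LeafSystem.lf` with the family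
# constant `d = 6/log L` EXPLICIT

HONEST FRAMING (lane PLAN.md §0, binding).  [B10] = T. Bałaban, *Ultraviolet stability of three-dimensional lattice pure
gauge field theories*, Commun. Math. Phys. **102** (1985) 255–275 [Balaban1985UV3] proves UV stability of the d = 3 Wilson
lattice gauge theory on a finite torus; NOT a continuum limit, NOT d = 4, NOT the Clay problem.  This file asserts NOTHING of
the paper: it is kernel-checked BOOKKEEPING over the 4D cell's abstract carriers `B10.TowerRun` (one run of the
construction, (41)/(47) p. 266–267) and `B10LargeFieldSum.HistModel` (the discrete large-field histories of (41)), to be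
INSTANTIATED at the lane's concrete carriers `run3` (seat p1) — carrier-parametric first (lead ruling STATUS 2026-08-21T23:45:23Z).

WHAT IS PROVED HERE (all re-derived bookkeeping; journal page = PDF page + 254; quotations read on the renders
`run/shared/lean/pub/pub-balaban/b2b-balaban-ref1/pages/1985-cmp102-uv-stability-3d/…-p019-x2.png`, `…-p020-x2.png`):
* `sum_sum_mem_le_mul_sum` — double counting: `Σ_{e∈s} Σ_{p∈R(e)} f(p) ≤ m·Σ_{p∈t} f(p)` when every `p` lies in at most
  `m` of the regions `R(e) ⊆ t` and `f ≥ 0`.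
* `smallFactorsAll_of_perPlaquette` — p. 273 [19], (71) and the sentence after it, verbatim: *«Thus the part of the action
  (1/g_k²)A^η(U_k) localized to the sum of four j-blocks Δ′ connected with the plaquette p′ can be bounded from below by
  ¼p²(g_j), and the corresponding part of the exponential gives the small factor exp(−¼p²(g_j)). We get these small
  factors for all plaquettes in all large fields set P.»* — the passage from the PER-PLAQUETTE bound (71) (kernel-checked
  for the concrete average in `…B10Eq71Concrete.smallFactor_specialUnitary`, up to the trace-normalisation factor `N` of
  cell DIVERGENCE D-b10.1) to the leaf `SmallFactorsAll X c₁ gs` that `largeFieldControl_of_resummation` consumes FOR ALL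
  PLAQUETTES SIMULTANEOUSLY: print treats the regions Δ′(p′) of distinct large-field plaquettes as disjoint; with a cover
  multiplicity `m` (each fine plaquette lies in at most `m` regions Δ′(p′)) and the main action a sum of NONNEGATIVE
  plaquette terms, one gets the leaf with the honest overlap constant `c₁ = 1/(N·m)` (4D cell GAPS G-B10-10(a)).
* `largeFieldControl_explicit`, `largeFieldControl_explicit_gRun` — the sentence pp. 273–274 [19–20] *«The analysis of
  Sect. 3.C [9], which is model independent, show that these small factors are enough to control all sums in (41),
  together with the second term in (65) ⟦(66)⟧. This gives the upper bound in (5).»* in the 4D cell's kernel form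
  `B10LargeFieldSum.largeFieldControl_of_resummation(_gRun)` BUT WITH THE CONSTANT EXPLICIT: the cell's theorem concludes
  `B10.LargeFieldControlPrinted T` = `∃ d ≥ 0, …`, which cannot feed the FAMILY constant `B10Assembly.Consts.d` of
  `LeafSystem.lf` (Theorem 1's «O(1) independent of ε», p. 257 [3] L1); here the same proof (ADAPTED, with attribution, from
  `…B10LargeFieldSum` ll. 412–565, unit b2b-balaban-b10-g3) yields `d = 3/ℓ`, `ℓ = ½ log L`, i.e. `d = 6/log L` on the printed
  flow `g_j = g(L^jε)^{1/2}`.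
* `lf_leaf_of_leaves` — the field `B10Assembly.LeafSystem.lf` (B10Assembly.lean ll. 294–295) for ANY `Consts` with
  `C.d = 6/log C.L`, from the three leaves.
* §4 `bookedCZ_le_xlog`, `ztermRate_of_booked` — the leaf `ZtermRate X A` from the lane's BOOKED Z-terms
  `Zterm k h = Σ_{j<k} CZ_j·|Z_j|(h)` (LEAF-LEDGER A8) with `A = (Cz + Cv) + C₅ + C₆ + (|log σ₀| + d(𝔤))·c₁`.
PROVISOS NOT IN PRINT (carried as hypotheses, never discharged here; lane STATUS 2026-08-21 p2 GAP note): `3r₀ + 2 ≤ 2p₀`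
(4D cell GAPS G-B10-02 / G-adv2-7; print (7) p. 257: «p₀ > 2», `r₀` free) and the two `b₀`-thresholds (GAPS G-B10-10(d);
print p. 257: «b₀ is a sufficiently large absolute constant»).
-/

namespace Summit.QuantumFields.Balaban3D.Proofs.LargeFieldKnit

open Literature.MathematicalPhysics.QuantumFieldTheory.Balaban1983to89
open B10LargeField B10LargeFieldSum
open Finset

/-! ## §1 Double counting over a cover of bounded multiplicity -/

section DoubleCounting

/-- DOUBLE COUNTING.  For regions `R e ⊆ t` (`e ∈ s`) covering each point `p ∈ t` at most `m` times and a nonnegative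
`f`, `Σ_{e ∈ s} Σ_{p ∈ R e} f p ≤ m · Σ_{p ∈ t} f p`.  (Used with `t` = the fine plaquettes, `R (j, p′) = Δ′(p′)` = the
plaquettes of the four `j`-blocks at the corners of the large-field plaquette `p′`, p. 273 [19].) [folklore] -/
theorem sum_sum_mem_le_mul_sum {α β : Type*} [DecidableEq β] (s : Finset α) (t : Finset β) (R : α → Finset β)
    (f : β → ℝ) (hf : ∀ p ∈ t, 0 ≤ f p) (hR : ∀ e ∈ s, R e ⊆ t) (m : ℕ)
    (hmult : ∀ p ∈ t, (s.filter (fun e => p ∈ R e)).card ≤ m) :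
    ∑ e ∈ s, ∑ p ∈ R e, f p ≤ m * ∑ p ∈ t, f p := by
  classical
  calc ∑ e ∈ s, ∑ p ∈ R e, f p
      = ∑ e ∈ s, ∑ p ∈ t, (if p ∈ R e then f p else 0) := by
        refine Finset.sum_congr rfl fun e he => ?_
        rw [Finset.sum_ite_mem, Finset.inter_eq_right.mpr (hR e he)]
    _ = ∑ p ∈ t, ∑ e ∈ s, (if p ∈ R e then f p else 0) := Finset.sum_comm
    _ = ∑ p ∈ t, ((s.filter (fun e => p ∈ R e)).card : ℝ) * f p := by
        refine Finset.sum_congr rfl fun p _ => ?_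
        rw [Finset.card_filter, Nat.cast_sum, Finset.sum_mul]
        refine Finset.sum_congr rfl fun e _ => ?_
        split_ifs <;> simp
    _ ≤ ∑ p ∈ t, (m : ℝ) * f p := by
        refine Finset.sum_le_sum fun p hp => ?_
        exact mul_le_mul_of_nonneg_right (by exact_mod_cast hmult p hp) (hf p hp)
    _ = m * ∑ p ∈ t, f p := by rw [Finset.mul_sum]

end DoubleCounting

/-! ## §2 (67)–(71) for all large-field plaquettes ⇒ the leaf `SmallFactorsAll` -/

section SmallFactors

variable {T : B10.TowerRun}

/-- **p. 273 [19], after (71), verbatim: «We get these small factors for all plaquettes in all large fields set P.»**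
Let a run `T` carry a history model `X` (the discrete large-field histories of (41)); let the main action at step `k` be
(at least) `(1/g_k²)` times a finite sum of NONNEGATIVE plaquette terms `act k h U p` (print: `η⁻¹[1 − Re tr U_k(∂p)]`,
(5) p. 256 / (71) p. 273); let every large-field plaquette `e = (j, p′)` of the history carry a finite region `Δ′ e` of fine
plaquettes (print: *«Δ′ = B^j(x₀) ∪ B^j(y₀) ∪ B^j(z₀) ∪ B^j(w₀)»*, p. 273 L22) such that each fine plaquette lies in at most
`m` regions; and let the PER-PLAQUETTE bound (71) hold in the form the concrete theorem
`B10Eq71Concrete.smallFactor_specialUnitary` delivers it, *«¼p²(g_j) ≤ N·(1/g_k²)·Σ_{p⊂Δ′} η⁻¹[1 − Re tr U_k(∂p)]»* (`N` =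
the trace-normalisation factor of cell DIVERGENCE D-b10.1; print has `N = 1`), for every `e ∈ disc k h` in the regime
`0 < g_j ≤ g̃`.  THEN the leaf `SmallFactorsAll X c₁ g̃` holds with `c₁ = 1/(N·m)` — the overlap constant the 4D cell
records as GAPS G-B10-10(a) (print: regions disjoint, `c₁ = 1`).  Re-derived bookkeeping (double counting); no content of
the series. [cite: Balaban1985UV3, (71) p.273] -/
theorem smallFactorsAll_of_perPlaquette (X : HistModel T) {gs Nd : ℝ} {m : ℕ}
    (Pl : ℕ → Type*) [∀ k, Fintype (Pl k)] [∀ k, DecidableEq (Pl k)]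
    (act : (k : ℕ) → T.Hist k → T.Cfg k → Pl k → ℝ)
    (hact : ∀ (k : ℕ) (h : T.Hist k) (U : T.Cfg k) (p : Pl k), 0 ≤ act k h U p)
    (hmain : ∀ k, k ≤ T.K → ∀ (h : T.Hist k) (U : T.Cfg k),
      (T.g k)⁻¹ ^ 2 * ∑ p, act k h U p ≤ T.mainT k h U)
    (Δ' : (k : ℕ) → ℕ × X.α → Finset (Pl k)) (hm : 0 < m) (hN : 0 < Nd)
    (hmult : ∀ k, k ≤ T.K → ∀ (h : T.Hist k) (p : Pl k),
      ((X.disc k h).filter (fun e => p ∈ Δ' k e)).card ≤ m)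
    (h71 : (∀ j, j ≤ T.K → 0 < T.g j ∧ T.g j ≤ gs) → ∀ k, k ≤ T.K → ∀ (U : T.Cfg k) (h : T.Hist k),
      ∀ e ∈ X.disc k h, B10.pFun T.b₀ T.p₀ (T.g e.1) ^ 2 / 4 ≤
        Nd * ((T.g k)⁻¹ ^ 2 * ∑ p ∈ Δ' k e, act k h U p)) :
    SmallFactorsAll X (1 / (Nd * m)) gs := by
  intro hg k hk U h
  have hsum : ∑ e ∈ X.disc k h, B10.pFun T.b₀ T.p₀ (T.g e.1) ^ 2 / 4
      ≤ Nd * ((T.g k)⁻¹ ^ 2 * ∑ e ∈ X.disc k h, ∑ p ∈ Δ' k e, act k h U p) := by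
    calc ∑ e ∈ X.disc k h, B10.pFun T.b₀ T.p₀ (T.g e.1) ^ 2 / 4
        ≤ ∑ e ∈ X.disc k h, Nd * ((T.g k)⁻¹ ^ 2 * ∑ p ∈ Δ' k e, act k h U p) :=
          Finset.sum_le_sum (h71 hg k hk U h)
      _ = Nd * ((T.g k)⁻¹ ^ 2 * ∑ e ∈ X.disc k h, ∑ p ∈ Δ' k e, act k h U p) := by
          rw [Finset.mul_sum, Finset.mul_sum]
  have hdc : ∑ e ∈ X.disc k h, ∑ p ∈ Δ' k e, act k h U p ≤ m * ∑ p, act k h U p :=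
    sum_sum_mem_le_mul_sum (X.disc k h) Finset.univ (Δ' k) (act k h U) (fun p _ => hact k h U p)
      (fun _ _ => Finset.subset_univ _) m (fun p _ => hmult k hk h p)
  have hg0 : 0 ≤ (T.g k)⁻¹ ^ 2 := sq_nonneg _
  have hNm : (0 : ℝ) < Nd * m := by positivity
  calc 1 / (Nd * m) * ∑ e ∈ X.disc k h, B10.pFun T.b₀ T.p₀ (T.g e.1) ^ 2 / 4
      ≤ 1 / (Nd * m) * (Nd * ((T.g k)⁻¹ ^ 2 * (m * ∑ p, act k h U p))) := by
        refine mul_le_mul_of_nonneg_left (hsum.trans ?_) (by positivity)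
        exact mul_le_mul_of_nonneg_left (mul_le_mul_of_nonneg_left hdc hg0) hN.le
    _ = (T.g k)⁻¹ ^ 2 * ∑ p, act k h U p := by
        field_simp
    _ ≤ T.mainT k h U := hmain k hk h U

end SmallFactors

/-! ## §3 The three large-field leaves ⇒ `LeafSystem.lf` with `d = 6/log L` explicit -/

section Explicit

variable {T : B10.TowerRun}

/-- **pp. 273–274 [19–20], verbatim: «The analysis of Sect. 3.C [9], which is model independent, show that these small
factors are enough to control all sums in (41), together with the second term in (65) ⟦(66)⟧. This gives the upper bound in
(5).»** — the 4D cell's kernel theorem `B10LargeFieldSum.largeFieldControl_of_resummation` (small factors for all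
large-field plaquettes + the rate of the volume terms of (41) + the counted collar cover of (39)/p. 268 ⇒ the large-field
histories are controlled) with the constant EXPLICIT: the conclusion is the bound `LF(−mainT + Zterm) ≤ exp((3/ℓ)|T₁^{(k)}|)`
itself rather than `∃ d`.  Hypotheses and proof exactly as there (provisos `3r₀ + 2 ≤ 2p₀`, `8(A + A₀)(c_gρ)³/ℓ ≤ c₁b₀²`,
`8(σ + ℓ) ≤ c₁b₀²ℓ` NOT IN PRINT: 4D cell GAPS G-B10-02, G-B10-10(d)); proof body ADAPTED from
`…Balaban1983to89.B10LargeFieldSum` ll. 421–540 (unit b2b-balaban-b10-g3), whose lemmas `perSource_net_le`,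
`exchange_sum`, `sum_powerset_exp_sum_le`, `sum_candidates_le`, `scaleEntropy_sum_le` are used by name.  Re-derived
bookkeeping; no content of the series. [cite: Balaban1985UV3, pp.273–274] -/
theorem largeFieldControl_explicit (X : HistModel T) {A c₁ gs cg ρ r₀ ℓ xK : ℝ}
    (hSF : SmallFactorsAll X c₁ gs) (hZ : ZtermRate X A) (hV : ZvolCover X cg ρ r₀)
    (hA : 0 ≤ A) (hcg : 0 ≤ cg * ρ) (hr : 0 ≤ r₀) (hℓ : 0 < ℓ)
    (hg : ∀ j, j ≤ T.K → 0 < T.g j ∧ T.g j ≤ gs) (hgs : gs ≤ 1)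
    (hx : ∀ j, j ≤ T.K → xlog (T.g j) = xK + ((T.K - j : ℕ) : ℝ) * ℓ)
    (hp : r₀ * 3 + 2 ≤ 2 * T.p₀)
    (hb₁ : 8 * ((A + X.A₀) * (cg * ρ) ^ 3 / ℓ) ≤ c₁ * T.b₀ ^ 2)
    (hb₂ : 8 * (X.σ + ℓ) ≤ c₁ * T.b₀ ^ 2 * ℓ) :
    ∀ k, k ≤ T.K → ∀ U : T.Cfg k,
      T.LF k U (fun h => -(T.mainT k h U) + T.Zterm k h) ≤ Real.exp (3 / ℓ * T.sites k) := by
  -- adapted from LQB `B10LargeFieldSum.largeFieldControl_of_resummation` (b2b-balaban-b10-g3), witness made explicit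
  intro k hk U
  have hc₁ : 0 ≤ c₁ * T.b₀ ^ 2 := by
    have h8 : 0 ≤ 8 * ((A + X.A₀) * (cg * ρ) ^ 3 / ℓ) := by
      have := X.A₀_nonneg
      positivity
    linarith
  -- the unit x_j = 1 + log g_j⁻¹ along the run
  set x : ℕ → ℝ := fun j => xlog (T.g j) with hxdef
  have hx1 : ∀ j, j ≤ T.K → 1 ≤ x j := fun j hj => one_le_xlog (hg j hj).1 ((hg j hj).2.trans hgs)
  have hxmono : ∀ i j, i ≤ j → j ≤ T.K → x j ≤ x i := by
    intro i j hij hj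
    show xlog (T.g j) ≤ xlog (T.g i)
    rw [hx i (hij.trans hj), hx j hj]
    have : ((T.K - j : ℕ) : ℝ) ≤ ((T.K - i : ℕ) : ℝ) := by exact_mod_cast Nat.sub_le_sub_left hij _
    nlinarith
  have hxdiff : ∀ i, i ≤ k → x i - x k = ((k - i : ℕ) : ℝ) * ℓ := by
    intro i hi
    show xlog (T.g i) - xlog (T.g k) = ((k - i : ℕ) : ℝ) * ℓ
    rw [hx i (hi.trans hk), hx k hk]
    have hcast : ((T.K - i : ℕ) : ℝ) = ((T.K - k : ℕ) : ℝ) + ((k - i : ℕ) : ℝ) := by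
      rw [← Nat.cast_add]
      congr 1
      omega
    rw [hcast]
    ring
  have hp1 : 1 ≤ 2 * T.p₀ := by linarith
  have hκ : 0 ≤ c₁ * T.b₀ ^ 2 / 8 := by positivity
  -- per-source data: collar volume, accumulated rates, gain
  let V : ℕ × X.α → ℝ := fun e => (cg * ρ) ^ 3 * x e.1 ^ (3 * r₀)
  let S : ℕ × X.α → ℝ := fun e => ∑ j ∈ (Finset.range k).filter (fun j => e.1 ≤ j), (A * x j + X.A₀)
  let gain : ℕ × X.α → ℝ := fun e => c₁ * (T.b₀ * x e.1 ^ T.p₀) ^ 2 / 4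
  let θ : ℕ × X.α → ℝ := fun e => -(c₁ * (T.b₀ * x e.1 ^ T.p₀) ^ 2 / 8)
  -- the bounding function of the discrete data
  let B : Finset (ℕ × X.α) → ℝ := fun Q =>
    -(∑ e ∈ Q, gain e) + ∑ j ∈ Finset.range k, A * x j * X.zvol k j Q
  have hFB : ∀ h, -(T.mainT k h U) + T.Zterm k h ≤ B (X.disc k h) := by
    intro h
    have h1 := hSF hg k hk U h
    have h2 := hZ k hk h
    have h3 : c₁ * ∑ e ∈ X.disc k h, B10.pFun T.b₀ T.p₀ (T.g e.1) ^ 2 / 4 = ∑ e ∈ X.disc k h, gain e := by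
      rw [Finset.mul_sum]
      refine Finset.sum_congr rfl fun e _ => ?_
      simp only [gain, pFun_eq, hxdef]
      ring
    show -(T.mainT k h U) + T.Zterm k h
        ≤ -(∑ e ∈ X.disc k h, gain e) + ∑ j ∈ Finset.range k, A * x j * X.zvol k j (X.disc k h)
    linarith
  have hdom := X.dominated k hk U (fun h => -(T.mainT k h U) + T.Zterm k h) B hFB
  -- each history's exponent is at most the sum of the surviving (halved) small factors of its plaquettes
  have hsummand : ∀ Q ∈ (X.E k).powerset,
      Real.exp (B Q + X.A₀ * ∑ j ∈ Finset.range k, X.zvol k j Q) ≤ Real.exp (∑ e ∈ Q, θ e) := by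
    intro Q hQ
    rw [Finset.mem_powerset] at hQ
    apply Real.exp_le_exp.mpr
    have hz : ∀ j ∈ Finset.range k, (A * x j + X.A₀) * X.zvol k j Q
        ≤ (A * x j + X.A₀) * ∑ e ∈ Q.filter (fun e => e.1 ≤ j), V e := by
      intro j hj
      rw [Finset.mem_range] at hj
      have hxj : 1 ≤ x j := hx1 j (by omega)
      have hrate : 0 ≤ A * x j + X.A₀ := by nlinarith [X.A₀_nonneg]
      exact mul_le_mul_of_nonneg_left (hV k hk Q hQ j hj) hrate
    have step1 : B Q + X.A₀ * ∑ j ∈ Finset.range k, X.zvol k j Q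
        = -(∑ e ∈ Q, gain e) + ∑ j ∈ Finset.range k, (A * x j + X.A₀) * X.zvol k j Q := by
      show (-(∑ e ∈ Q, gain e) + ∑ j ∈ Finset.range k, A * x j * X.zvol k j Q)
          + X.A₀ * ∑ j ∈ Finset.range k, X.zvol k j Q
          = -(∑ e ∈ Q, gain e) + ∑ j ∈ Finset.range k, (A * x j + X.A₀) * X.zvol k j Q
      rw [Finset.mul_sum, add_assoc, ← Finset.sum_add_distrib]
      congr 1
      refine Finset.sum_congr rfl fun j _ => ?_
      ring
    have step2 : ∑ j ∈ Finset.range k, (A * x j + X.A₀) * ∑ e ∈ Q.filter (fun e => e.1 ≤ j), V e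
        = ∑ e ∈ Q, V e * S e := exchange_sum Q k (fun j => A * x j + X.A₀) V
    have step3 : ∀ e ∈ Q, -(gain e) + V e * S e ≤ θ e := by
      intro e he
      have heE : e ∈ X.E k := hQ he
      have hik : e.1 < k := X.E_lt k e heE
      exact perSource_net_le (x := x) hA X.A₀_nonneg hcg hℓ hik
        (fun j hj => hx1 j (hj.trans hk)) (fun j hij hj => hxmono e.1 j hij (hj.trans hk))
        (hxdiff e.1 hik.le) hp hb₁
    calc B Q + X.A₀ * ∑ j ∈ Finset.range k, X.zvol k j Q
        = -(∑ e ∈ Q, gain e) + ∑ j ∈ Finset.range k, (A * x j + X.A₀) * X.zvol k j Q := step1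
      _ ≤ -(∑ e ∈ Q, gain e) + ∑ j ∈ Finset.range k, (A * x j + X.A₀) * ∑ e ∈ Q.filter (fun e => e.1 ≤ j), V e :=
          by linarith [Finset.sum_le_sum hz]
      _ = -(∑ e ∈ Q, gain e) + ∑ e ∈ Q, V e * S e := by rw [step2]
      _ = ∑ e ∈ Q, (-(gain e) + V e * S e) := by
          rw [Finset.sum_add_distrib, Finset.sum_neg_distrib]
      _ ≤ ∑ e ∈ Q, θ e := Finset.sum_le_sum step3
  -- the surviving factor at scale j is at most e^{−κ x_j}, κ = c₁b₀²/8
  have hθ : ∀ e ∈ X.E k, Real.exp (θ e) ≤ Real.exp (-(c₁ * T.b₀ ^ 2 / 8 * x e.1)) := by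
    intro e he
    have hik : e.1 < k := X.E_lt k e he
    have hxe : 1 ≤ x e.1 := hx1 e.1 (by omega)
    have hx0 : 0 ≤ x e.1 := by linarith
    apply Real.exp_le_exp.mpr
    have h2 : (x e.1 ^ T.p₀) ^ 2 = x e.1 ^ (2 * T.p₀) := by
      rw [mul_comm, Real.rpow_mul hx0, Real.rpow_two]
    have h3 : x e.1 ≤ x e.1 ^ (2 * T.p₀) := by
      have := Real.rpow_le_rpow_of_exponent_le hxe hp1
      rwa [Real.rpow_one] at this
    have h4 : c₁ * T.b₀ ^ 2 / 8 * x e.1 ≤ c₁ * T.b₀ ^ 2 / 8 * (x e.1 ^ T.p₀) ^ 2 := by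
      rw [h2]
      exact mul_le_mul_of_nonneg_left h3 hκ
    show -(c₁ * (T.b₀ * x e.1 ^ T.p₀) ^ 2 / 8) ≤ -(c₁ * T.b₀ ^ 2 / 8 * x e.1)
    rw [mul_pow]
    linarith
  have hxj : ∀ j, j < k → 1 + ((k - j : ℕ) : ℝ) * ℓ ≤ x j := by
    intro j hj
    have := hxdiff j hj.le
    have := hx1 k hk
    linarith
  have hκℓ : X.σ + ℓ ≤ c₁ * T.b₀ ^ 2 / 8 * ℓ := by linarith
  have hfinal : ∑ e ∈ X.E k, Real.exp (θ e) ≤ 3 / ℓ * T.sites k := by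
    calc ∑ e ∈ X.E k, Real.exp (θ e) ≤ ∑ e ∈ X.E k, Real.exp (-(c₁ * T.b₀ ^ 2 / 8 * x e.1)) :=
          Finset.sum_le_sum hθ
      _ ≤ ∑ j ∈ Finset.range k,
            3 * Real.exp (X.σ * ((k - j : ℕ) : ℝ)) * T.sites k * Real.exp (-(c₁ * T.b₀ ^ 2 / 8 * x j)) :=
          sum_candidates_le X k (fun j => Real.exp (-(c₁ * T.b₀ ^ 2 / 8 * x j))) fun j => (Real.exp_pos _).le
      _ ≤ 3 * T.sites k / ℓ :=
          scaleEntropy_sum_le x k hℓ (T.sites_nonneg k) hκ hκℓ hxj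
      _ = 3 / ℓ * T.sites k := by ring
  calc T.LF k U (fun h => -(T.mainT k h U) + T.Zterm k h)
      ≤ ∑ Q ∈ (X.E k).powerset, Real.exp (B Q + X.A₀ * ∑ j ∈ Finset.range k, X.zvol k j Q) := hdom
    _ ≤ ∑ Q ∈ (X.E k).powerset, Real.exp (∑ e ∈ Q, θ e) := Finset.sum_le_sum hsummand
    _ ≤ Real.exp (∑ e ∈ X.E k, Real.exp (θ e)) := sum_powerset_exp_sum_le _ θ
    _ ≤ Real.exp (3 / ℓ * T.sites k) := Real.exp_le_exp.mpr hfinal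

/-- **The same on the printed flow** `g_j = g(L^jε)^{1/2}` (p. 256 [2]; `B10.gRun`), `ℓ = ½ log L`, `σ = 3 log L`: the
large-field histories with the Z-terms are controlled with the EXPLICIT constant `d = 6/log L`,
`LF(−mainT + Zterm) ≤ exp((6/log L)|T₁^{(k)}|)` for every `k ≤ K` — the shape of `B10Assembly.LeafSystem.lf`.  As
`B10LargeFieldSum.largeFieldControl_of_resummation_gRun` (progression hypothesis = `B10LargeField.xlog_gRun`, scale
condition `c₁b₀² ≥ 56`), witness made explicit. [cite: Balaban1985UV3, pp.273–274] -/
theorem largeFieldControl_explicit_gRun (X : HistModel T) {A c₁ gs cg ρ r₀ g L ε : ℝ}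
    (hSF : SmallFactorsAll X c₁ gs) (hZ : ZtermRate X A) (hV : ZvolCover X cg ρ r₀)
    (hA : 0 ≤ A) (hcg : 0 ≤ cg * ρ) (hr : 0 ≤ r₀) (hg0 : 0 < g) (hL : 1 < L) (hε : 0 < ε)
    (hrun : ∀ j, T.g j = B10.gRun g L ε j)
    (hg : ∀ j, j ≤ T.K → 0 < T.g j ∧ T.g j ≤ gs) (hgs : gs ≤ 1)
    (hσ : X.σ = 3 * Real.log L)
    (hp : r₀ * 3 + 2 ≤ 2 * T.p₀)
    (hb₁ : 8 * ((A + X.A₀) * (cg * ρ) ^ 3 / (Real.log L / 2)) ≤ c₁ * T.b₀ ^ 2)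
    (hb₂ : 56 ≤ c₁ * T.b₀ ^ 2) :
    ∀ k, k ≤ T.K → ∀ U : T.Cfg k,
      T.LF k U (fun h => -(T.mainT k h U) + T.Zterm k h) ≤ Real.exp (6 / Real.log L * T.sites k) := by
  have hlog : 0 < Real.log L := Real.log_pos hL
  have hℓ : 0 < Real.log L / 2 := by positivity
  have hmain := largeFieldControl_explicit X (xK := xlog (T.g T.K)) hSF hZ hV hA hcg hr hℓ hg hgs
    (fun j hj => by rw [hrun j, hrun T.K]; exact xlog_gRun g L ε hg0 (by linarith) hε hj) hp hb₁
    (by rw [hσ]; nlinarith)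
  intro k hk U
  have h6 : (3 : ℝ) / (Real.log L / 2) = 6 / Real.log L := by
    field_simp
    ring
  rw [← h6]
  exact hmain k hk U

/-- **The field `B10Assembly.LeafSystem.lf`** (B10Assembly.lean ll. 294–295: «pp. 273–274: the large-field histories with
the Z-terms are controlled, constant d») for ANY family of constants `C` with `C.d = 6/log C.L`, from the three large-field
leaves over a history model of the run, on the printed flow `g_j = g(L^jε)^{1/2}` with `g = C.g`, `L = C.L`: the statement is
LITERALLY the field type (so that a `LeafSystem C run3` instance takes `lf := lf_leaf_of_leaves …`).  Provisos as in
`largeFieldControl_explicit` (NOT IN PRINT). [cite: Balaban1985UV3, pp.273–274] -/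
theorem lf_leaf_of_leaves (C : B10Assembly.Consts) (hd : C.d = 6 / Real.log C.L) (X : HistModel T)
    {A c₁ gs cg ρ r₀ ε : ℝ}
    (hSF : SmallFactorsAll X c₁ gs) (hZ : ZtermRate X A) (hV : ZvolCover X cg ρ r₀)
    (hA : 0 ≤ A) (hcg : 0 ≤ cg * ρ) (hr : 0 ≤ r₀) (hε : 0 < ε)
    (hrun : ∀ j, T.g j = B10.gRun C.g C.L ε j)
    (hg : ∀ j, j ≤ T.K → 0 < T.g j ∧ T.g j ≤ gs) (hgs : gs ≤ 1)
    (hσ : X.σ = 3 * Real.log C.L)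
    (hp : r₀ * 3 + 2 ≤ 2 * T.p₀)
    (hb₁ : 8 * ((A + X.A₀) * (cg * ρ) ^ 3 / (Real.log C.L / 2)) ≤ c₁ * T.b₀ ^ 2)
    (hb₂ : 56 ≤ c₁ * T.b₀ ^ 2) :
    ∀ k, k ≤ T.K → ∀ U : T.Cfg k,
      T.LF k U (fun h => -(T.mainT k h U) + T.Zterm k h) ≤ Real.exp (C.d * T.sites k) := by
  rw [hd]
  exact largeFieldControl_explicit_gRun X hSF hZ hV hA hcg hr C.g_pos C.one_lt_L hε hrun hg hgs hσ hp hb₁ hb₂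

end Explicit

/-! ## §4 The leaf `ZtermRate` from the BOOKED Z-terms of (41) -/

section ZtermRate

variable {T : B10.TowerRun}

/-- The booked coefficient of `|Z_j|` is affine in `log g_j⁻¹`, hence at most `A·x(g_j)`, `x(g) = 1 + log g⁻¹ ≥ 1`:
with the lane's booking (LEAF-LEDGER A8, lead ruling R-PIECES 2026-08-21: `CZ_j = (Cz + Cv)·g_j + C₅ + C₆ + (|log σ₀| +
d(𝔤)·log g_j⁻¹)·c₁`, the rate of `B10SectAGathering.StepLeaves.ztermSucc` l. 609) and `0 < g_j ≤ 1`, nonnegative constants,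
`CZ_j ≤ ((Cz + Cv) + C₅ + C₆ + (|log σ₀| + d(𝔤))·c₁)·x(g_j)`.  Real arithmetic. [cite: Balaban1985UV3, (41) p.266] -/
theorem bookedCZ_le_xlog {Cz Cv C₅ C₆ σabs dg c₁ g : ℝ} (hCz : 0 ≤ Cz + Cv) (h5 : 0 ≤ C₅) (h6 : 0 ≤ C₆) (hσ : 0 ≤ σabs)
    (hdg : 0 ≤ dg) (hc₁ : 0 ≤ c₁) (hg : 0 < g) (hg1 : g ≤ 1) :
    (Cz + Cv) * g + C₅ + C₆ + (σabs + dg * Real.log g⁻¹) * c₁ ≤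
      ((Cz + Cv) + C₅ + C₆ + (σabs + dg) * c₁) * xlog g := by
  have hu : 0 ≤ Real.log g⁻¹ := B10.log_inv_nonneg_of_le_one hg hg1
  have hx : xlog g = 1 + Real.log g⁻¹ := rfl
  rw [hx]
  nlinarith [mul_nonneg hσ hc₁, mul_nonneg hdg hc₁, mul_nonneg (mul_nonneg hdg hc₁) hu, mul_nonneg h5 hu,
    mul_nonneg h6 hu, mul_nonneg hCz hu, mul_nonneg (mul_nonneg hσ hc₁) hu]

/-- **The leaf `B10LargeFieldSum.ZtermRate X A`** (p. 266 [12] (41): *«+ Σ_{j=0}^{k−1} O(log g_j⁻¹)|Z_j|»*, the O-constant named)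
for a run whose Z-terms are BOOKED as `Zterm k h = Σ_{j<k} CZ_j·|Z_j|(h)` (lane LEAF-LEDGER A8) with per-scale coefficients
`0 ≤ CZ_j ≤ A·x(g_j)` (`bookedCZ_le_xlog`) and whose history model DOMINATES the volumes by a function of the discrete data,
`0 ≤ |Z_j|(h) ≤ X.zvol k j (X.disc k h)` for `j < k ≤ K` (e.g. `zvol` := the collar count of `ZvolCover` itself): then `ZtermRate X A`.
Definitional bookkeeping. [cite: Balaban1985UV3, (41) p.266] -/
theorem ztermRate_of_booked (X : HistModel T) {A : ℝ} (CZ : ℕ → ℝ) (vol : (k : ℕ) → T.Hist k → ℕ → ℝ)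
    (hZterm : ∀ (k : ℕ) (h : T.Hist k), T.Zterm k h = ∑ j ∈ Finset.range k, CZ j * vol k h j)
    (hzvol : ∀ k, k ≤ T.K → ∀ (h : T.Hist k) (j : ℕ), j < k → vol k h j ≤ X.zvol k j (X.disc k h))
    (hvol : ∀ (k : ℕ) (h : T.Hist k) (j : ℕ), 0 ≤ vol k h j)
    (hCZ0 : ∀ j, j < T.K → 0 ≤ CZ j) (hCZ : ∀ j, j < T.K → CZ j ≤ A * xlog (T.g j)) :
    ZtermRate X A := by
  intro k hk h
  rw [hZterm k h]
  refine Finset.sum_le_sum fun j hj => ?_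
  have hjk : j < k := Finset.mem_range.mp hj
  have hjK : j < T.K := lt_of_lt_of_le hjk hk
  have hzv := hzvol k hk h j hjk
  have hz0 : 0 ≤ X.zvol k j (X.disc k h) := (hvol k h j).trans hzv
  calc CZ j * vol k h j ≤ CZ j * X.zvol k j (X.disc k h) := mul_le_mul_of_nonneg_left hzv (hCZ0 j hjK)
    _ ≤ A * xlog (T.g j) * X.zvol k j (X.disc k h) := mul_le_mul_of_nonneg_right (hCZ j hjK) hz0

end ZtermRate

end Summit.QuantumFields.Balaban3D.Proofs.LargeFieldKnit
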